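import Summits.QuantumFields.YangMills.Theorems.FemtoCutoffLadderSubOctaveBoundedUpStepDoor
import Summits.QuantumFields.YangMills.Theorems.FemtoCutoffLadderThinning
import Summits.QuantumFields.YangMills.Theorems.LuscherReductionOneSiteLevelsIMS
import HarnessLib

/-!
# Femto transfer gap — the upward incommensurable step of crux `SubOctaveBounded` (stmt-QuantumFields-24085) reduced to THREE VACUUM MOMENTS
# of one pulled-back observable (the concrete supplier interface behind `UpStep.upStepAt_of_dynComparisonAt`)

Seat `ym-line-fcl-p3` (2026-08-28).  Route-independent (no `Theses` import).  Fix a fine lattice `(ℤ/L)³` at coupling `β`, its physical normalised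
exact ground state `Ω` (`K_βΩ = λ₀Ω`), and ANY physical `w` (the intended one: `w = (g ∘ thin L')·Ω`, `g` the coarse first excitation in
ground-state representation — physical by `isPhys_groundRep_pullback`).  With the three fine VACUUM MOMENTS

  `m = ⟨w, Ω⟩`,  `E₂ = ⟨w, w⟩`,  `E₃ = ⟨w, K_β^L w⟩`  (mean, second moment, physical-time-1 two-time function of the blocked observable),

the re-centred trial vector `v = w − mΩ` is physical, `⊥ Ω`, and has EXACTLY `‖v‖² = E₂ − m²`, `⟨v, K_β^L v⟩ = E₃ − λ₀^L m²` (§2: `K^L` is linear and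
symmetric on physical functions, `K^LΩ = λ₀^LΩ`).  Hence (§3) ★ `upStepAt_of_moments`: the single numeric inequality
`λ₁(β',L')^{L'}·λ₀(β,L)^L·(E₂ − m²) ≤ e^{s}·λ₀(β',L')^{L'}·(E₃ − λ₀^L m²)` (with `E₂ − m² > 0`), for every such `Ω` and some physical `w`, gives the
upward step `λ₁(β',L')^{L'}·λ₀(β,L)^L ≤ e^{s}·λ₁(β,L)^L·λ₀(β',L')^{L'}` at that pair.  The coarse values of the three moments for `g = e₁'/Ω'` are
`0, 1, (λ₁'/λ₀')^{L'}·λ₀…` — so what a two-cutoff (Bałaban/King-type) supplier has to deliver is: `m = O(Λ)`, `E₂ = 1 + O(Λ²)`-type control and the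
two-time function `E₃/λ₀^L ≥ e^{−CΛ²}(λ₁'/λ₀')^{L'} + …`, uniformly in `L`.  Nothing of that is proved here.

HONEST FRAMING: fixed-lattice bookkeeping; R2b1 is a RECORD rung; no step and no summit is proved.  No definitions, no named facts, no `sorry`.
-/

set_option autoImplicit false

noncomputable section

namespace Summit.QuantumFields.YangMills.Theorems.FemtoTransferGap.UpStep

open MeasureTheory
open Literature.MathematicalPhysics.QuantumFieldTheory
open Summit.QuantumFields.YangMills.Theorems.FemtoTransferGap
open Summit.QuantumFields.YangMills.Theorems.FemtoCutoffLadder.Thinning (thin isPhys_comp_thin)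

variable {L : ℕ} [NeZero L]

/-! ## §1 The intended trial observable is physical -/

/-- **The pulled-back ground-state-representation observable is physical**: for a coarse physical `g` on `(ℤ/L')³` (`L' ≤ L ≤ 2L'`) and a fine
physical `Ω`, `U ↦ g(thin U)·Ω(U)` is a physical zero-flux test function of the fine torus. [cite: Luscher1983] -/
theorem isPhys_groundRep_pullback {L' : ℕ} [NeZero L'] (hLL : L' ≤ L) (h2 : L ≤ 2 * L') {g : GaugeConfig 3 L' SU2 → ℝ} (hg : IsPhys g)
    {Ω : GaugeConfig 3 L SU2 → ℝ} (hΩ : IsPhys Ω) : IsPhys (fun U : GaugeConfig 3 L SU2 => g (thin L' U) * Ω U) := by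
  have hp : IsPhys (fun U : GaugeConfig 3 L SU2 => g (thin L' U)) := isPhys_comp_thin hLL h2 hg
  obtain ⟨C, hC⟩ := hp.bounded
  exact hΩ.mul_of_invariant hp.measurable hC hp.gaugeInv hp.zeroFlux

/-! ## §2 Linear algebra of the re-centred trial vector -/

/-- `K_β^n` is additive on physical test functions. [folklore] -/
theorem iterate_transferApply_add (β : ℝ) {ψ φ : GaugeConfig 3 L SU2 → ℝ} (hψ : IsPhys ψ) (hφ : IsPhys φ) (n : ℕ) :
    (transferApply β)^[n] (ψ + φ) = (transferApply β)^[n] ψ + (transferApply β)^[n] φ := by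
  induction n with
  | zero => rfl
  | succ n ih =>
    rw [Function.iterate_succ_apply', Function.iterate_succ_apply', Function.iterate_succ_apply', ih,
      transferApply_add β (isPhys_iterate_transferApply β hψ n) (isPhys_iterate_transferApply β hφ n)]

/-- `K_β^n` is homogeneous. [folklore] -/
theorem iterate_transferApply_smul (β c : ℝ) (ψ : GaugeConfig 3 L SU2 → ℝ) (n : ℕ) :
    (transferApply β)^[n] (c • ψ) = c • (transferApply β)^[n] ψ := by
  induction n with
  | zero => rfl
  | succ n ih => rw [Function.iterate_succ_apply', Function.iterate_succ_apply', ih, transferApply_smul]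

/-- `K_β^n` is symmetric on physical test functions: `⟨K^n f, g⟩ = ⟨f, K^n g⟩`. [cite: SeilerLNP1982, §3] -/
theorem l2_iterate_transferApply_comm (β : ℝ) {f g : GaugeConfig 3 L SU2 → ℝ} (hf : IsPhys f) (hg : IsPhys g) (n : ℕ) :
    l2 ((transferApply β)^[n] f) g = l2 f ((transferApply β)^[n] g) := by
  induction n generalizing f g with
  | zero => rfl
  | succ n ih =>
    rw [Function.iterate_succ_apply', l2_transferApply_comm β (isPhys_iterate_transferApply β hf n) hg, ih hf (isPhys_transferApply β hg),
      ← Function.iterate_succ_apply (transferApply β) n g]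

/-- **Moments of the re-centred vector.**  For physical `Ω` (`‖Ω‖ = 1`, `K_βΩ = λ₀Ω`) and physical `w`, the vector `v = w + (−⟨w,Ω⟩)•Ω` is
physical, orthogonal to `Ω`, with `‖v‖² = ⟨w,w⟩ − ⟨w,Ω⟩²` and `⟨v, K_β^n v⟩ = ⟨w, K_β^n w⟩ − λ₀^n⟨w,Ω⟩²`. [cite: ReedSimonIV1978, Thm. XIII.1] -/
theorem recentred_moments (β : ℝ) {Ω w : GaugeConfig 3 L SU2 → ℝ} (hΩ : IsPhys Ω) (hΩ1 : l2 Ω Ω = 1)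
    (hΩeig : transferApply β Ω = topValue su2Rep L β • Ω) (hw : IsPhys w) (n : ℕ) :
    IsPhys (w + (-(l2 w Ω)) • Ω) ∧ l2 (w + (-(l2 w Ω)) • Ω) Ω = 0 ∧
      l2 (w + (-(l2 w Ω)) • Ω) (w + (-(l2 w Ω)) • Ω) = l2 w w - l2 w Ω ^ 2 ∧
      l2 (w + (-(l2 w Ω)) • Ω) ((transferApply β)^[n] (w + (-(l2 w Ω)) • Ω)) =
        l2 w ((transferApply β)^[n] w) - topValue su2Rep L β ^ n * l2 w Ω ^ 2 := by
  obtain ⟨m, hm⟩ : ∃ m : ℝ, l2 w Ω = m := ⟨_, rfl⟩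
  rw [hm]
  have hmΩ : IsPhys ((-m) • Ω) := hΩ.smul (-m)
  have hv : IsPhys (w + (-m) • Ω) := hw.add hmΩ
  have hΩw : l2 Ω w = m := by rw [l2_comm, hm]
  -- orthogonality
  have horth : l2 (w + (-m) • Ω) Ω = 0 := by
    rw [l2_add_left hw hmΩ hΩ, l2_smul_left, hm, hΩ1]; ring
  -- norm
  have hnorm : l2 (w + (-m) • Ω) (w + (-m) • Ω) = l2 w w - m ^ 2 := by
    rw [l2_add_left hw hmΩ hv, l2_smul_left, l2_comm w (w + (-m) • Ω), l2_comm Ω (w + (-m) • Ω), l2_add_left hw hmΩ hw,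
      l2_add_left hw hmΩ hΩ, l2_smul_left, l2_smul_left, hΩw, hm, hΩ1]
    ring
  -- two-time function
  have hKn : (transferApply β)^[n] (w + (-m) • Ω) = (transferApply β)^[n] w + ((-m) * topValue su2Rep L β ^ n) • Ω := by
    rw [iterate_transferApply_add β hw hmΩ, iterate_transferApply_smul, iterate_transferApply_ground hΩeig, smul_smul]
  have hKw : IsPhys ((transferApply β)^[n] w) := isPhys_iterate_transferApply β hw n
  have hsΩ : IsPhys (((-m) * topValue su2Rep L β ^ n) • Ω) := hΩ.smul _
  have hKv : IsPhys ((transferApply β)^[n] w + ((-m) * topValue su2Rep L β ^ n) • Ω) := hKw.add hsΩ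
  have hΩKw : l2 Ω ((transferApply β)^[n] w) = topValue su2Rep L β ^ n * m := by
    rw [← l2_iterate_transferApply_comm β hΩ hw, iterate_transferApply_ground hΩeig, l2_smul_left, hΩw]
  have htwo : l2 (w + (-m) • Ω) ((transferApply β)^[n] (w + (-m) • Ω)) =
      l2 w ((transferApply β)^[n] w) - topValue su2Rep L β ^ n * m ^ 2 := by
    rw [hKn, l2_add_left hw hmΩ hKv, l2_smul_left, l2_comm w (_ + _), l2_comm Ω (_ + _), l2_add_left hKw hsΩ hw,
      l2_add_left hKw hsΩ hΩ, l2_smul_left, l2_smul_left, hΩw, hΩ1, l2_comm ((transferApply β)^[n] w) Ω, hΩKw,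
      l2_comm ((transferApply β)^[n] w) w]
    ring
  exact ⟨hv, horth, hnorm, htwo⟩

/-! ## §3 ★ The upward step at one pair from three vacuum moments -/

/-- ★ **The upward step from three vacuum moments.**  At one pair — coarse `(L', β')`, fine `(L, β)` with `β ≥ 1`, slack `s` — suppose that for every
physical normalised exact ground state `Ω` of `K_β` there is a physical `w` with moments `m = ⟨w,Ω⟩`, `E₂ = ⟨w,w⟩`, `E₃ = ⟨w,K_β^L w⟩` satisfying
`m² < E₂` and `λ₁(β',L')^{L'}·λ₀(β,L)^L·(E₂ − m²) ≤ e^{s}·λ₀(β',L')^{L'}·(E₃ − λ₀(β,L)^L·m²)`.  Then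
`λ₁(β',L')^{L'}·λ₀(β,L)^L ≤ e^{s}·λ₁(β,L)^L·λ₀(β',L')^{L'}` (the door argument of `upStepAt_of_dynComparisonAt`, run on `v = w − mΩ`, §2).
[cite: ReedSimonIV1978, Thm. XIII.1] [cite: LuscherWeiszWolff1991] -/
theorem upStepAt_of_moments {L' : ℕ} [NeZero L'] {β β' s : ℝ} (hβ : 1 ≤ β)
    (hM : ∀ Ω : GaugeConfig 3 L SU2 → ℝ, IsPhys Ω → l2 Ω Ω = 1 → transferApply β Ω = topValue su2Rep L β • Ω →
      ∃ w : GaugeConfig 3 L SU2 → ℝ, IsPhys w ∧ l2 w Ω ^ 2 < l2 w w ∧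
        secondValue su2Rep L' β' ^ L' * topValue su2Rep L β ^ L * (l2 w w - l2 w Ω ^ 2) ≤
          Real.exp s * (topValue su2Rep L' β' ^ L' * (l2 w ((transferApply β)^[L] w) - topValue su2Rep L β ^ L * l2 w Ω ^ 2))) :
    secondValue su2Rep L' β' ^ L' * topValue su2Rep L β ^ L ≤
      Real.exp s * (secondValue su2Rep L β ^ L * topValue su2Rep L' β' ^ L') := by
  -- (the argument of `upStepAt_of_dynComparisonAt`, with the trial vector `v = w − ⟨w,Ω⟩Ω` of §2)
  have hβ0 : 0 < β := by linarith
  have hL1 : 1 ≤ L := NeZero.one_le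
  obtain ⟨Ω, θ, hΩ, -, hΩ1, hΩeig, -, -, -⟩ := PhysL2.exists_groundState_gap (L := L) β
  obtain ⟨w, hw, hvar, hineq⟩ := hM Ω hΩ hΩ1 hΩeig
  obtain ⟨hv, horth, hnorm, htwo⟩ := recentred_moments β hΩ hΩ1 hΩeig hw L
  set v : GaugeConfig 3 L SU2 → ℝ := w + (-(l2 w Ω)) • Ω with hvdef
  have hvpos : 0 < l2 v v := by rw [hnorm]; linarith
  have hcmp : secondValue su2Rep L' β' ^ L' * topValue su2Rep L β ^ L * l2 v v ≤
      Real.exp s * (topValue su2Rep L' β' ^ L' * l2 v ((transferApply β)^[L] v)) := by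
    rw [hnorm, htwo]; exact hineq
  have hvarb := l2_iterate_le_pow_secondValue hβ0 hΩ hΩ1 hΩeig hv horth hL1
  have hb' : 0 ≤ topValue su2Rep L' β' ^ L' := pow_nonneg (topValue_su2Rep_pos L' β').le _
  have h1 : Real.exp s * (topValue su2Rep L' β' ^ L' * l2 v ((transferApply β)^[L] v)) ≤
      Real.exp s * (topValue su2Rep L' β' ^ L' * (secondValue su2Rep L β ^ L * l2 v v)) :=
    mul_le_mul_of_nonneg_left (mul_le_mul_of_nonneg_left hvarb hb') (Real.exp_pos _).le
  have h2 := hcmp.trans h1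
  have h3 : (secondValue su2Rep L' β' ^ L' * topValue su2Rep L β ^ L) * l2 v v ≤
      (Real.exp s * (secondValue su2Rep L β ^ L * topValue su2Rep L' β' ^ L')) * l2 v v := by
    calc (secondValue su2Rep L' β' ^ L' * topValue su2Rep L β ^ L) * l2 v v
        = secondValue su2Rep L' β' ^ L' * topValue su2Rep L β ^ L * l2 v v := by ring
      _ ≤ Real.exp s * (topValue su2Rep L' β' ^ L' * (secondValue su2Rep L β ^ L * l2 v v)) := h2
      _ = (Real.exp s * (secondValue su2Rep L β ^ L * topValue su2Rep L' β' ^ L')) * l2 v v := by ring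
  exact le_of_mul_le_mul_right h3 hvpos

end Summit.QuantumFields.YangMills.Theorems.FemtoTransferGap.UpStep

end
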